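import Summits.CriticalPhenomena.PercolationContinuityZ3.Theorems.PercNearOneGluingNoHeavyQuantGluedSingleLayer
import HarnessLib

/-!
# QUANT lane R8, T-DEC: SECOND ERRATUM AND THE STATEMENT OF RECORD for the band of the glued-piece slice — the single-layer certificate needs the MASS SHIFT:
# `LawDec.GluedDominated′` (layer + mean tilt) is FALSE at the double edge `x = qg`, `S = xB`; `LawDec.GluedDominatedMass` (layer + mean tilt + mass shift)
# is the complete row-wise family, with the reductions re-proved and `GluedLemmaW ⟹` its conclusion at `a = 1` (arm-1 gen 58, architect — same seat, same day)

builds on p205010 (kernel theorem, internal audit signed; external expert review pending)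

Statement + support file (`--supports stmt-CriticalPhenomena-4575`), QUANT lane seat prim-quant-arm-1 (gen 58, architect); memo
`run/shared/lean/prim/quant/prim-quant-arm-1-g58/ARCH-G58.md` §0 (6″), §7.  One `@[conjecture]` (`GluedDominatedMass`), theorems; standard axioms, no sorries.

WHAT WAS STILL WRONG.  The certificate of `GluedDominated′` (`…QuantGluedDominationGuarded`) uses the identities available about the first factor `β` — its DEC datum at
ONE layer `J` (a price system) and its MEAN (`λ·Σβ(h)(h − S) = 0`) — but NOT its MASS (`d·(Σβ(h) − 1) = 0`).  The kit census at scale (✓ j287963/j287964, 5.1 M price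
systems) found 21 442 (0.42 %) with NO such certificate at any layer, all at the double edge `x = qg` ∧ `S = xB`; an exact rational instance: `r = 1`, `k = 5`, `q = 19/20`,
`g = 1`, `x = 19/20`, `B = 2`, `S = 19/10`, `a ∈ {39/40, 49/50, 99/100}`, `j ∈ {2, 3}`, the extreme certificate "every low at price 1, every giant at `(1−y)/y`": NO
`(J, α′, β′, λ)` exists (exact LP at every `J ≤ B`, `explore/famexact.py`), while with the mass shift `d` a certificate exists at EVERY `J` — so **`GluedDominated′` is
FALSE** (a kernel `¬` needs, per layer, an explicit sub-probability flow witness; left to a refuter, evidence on the item) and the mass row is necessary.  With `d` the family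
(price system at one layer + `λ` + `d`) is, by LP duality, COMPLETE for what one layer, the mean and the mass of `β` can certify; all 100 recorded failures of the kit
census are certified with `d`; a local census WITH the mass row (edge-heavy sampling, `kit/gdom/main.py` JOB_MASS=1): 42 427 / 42 427 price systems certified,
0 failures; kit re-run at scale ⧗ j290356/j290358 (`--workitem 4575`).
* **`LawDec.GluedDominatedMass`** (`@[conjecture]`): as `GluedDominated′` with the conclusion `∃ J α′ β′ λ d`: rows `Ψ(h) ≤ coefAt′(h) + λ(h − S) + d` (`h ≤ B`), gate row
  `(1−a)e(0) ≤ (1−a)coefAt′(0) − a·d`.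
* **`sdec_gluedPiece_band_of_dominatedMass`** (the reduction, with the mass identity), **`gluedPieceSlice_of_dominatedMass`** (g57's `hGPS`), **`sdec_cons_of_okPieces_of_dominatedMass`**.
* **`gluedDominatedMass_one_of_lemmaW`**: at `a = 1`, `GluedLemmaW ⟹` the conclusion of `GluedDominatedMass` (`d = 0`, from `gluedDominated_one_of_lemmaW`).
DEPENDENCY OF RECORD: band ⟸ `GluedDominatedMass` ⟸ {a = 1: `GluedLemmaW`; a < 1: `GluedLemmaW` + the gate row (ARCH-G58 §5)}.

HONEST STATUS.  `GluedDominated` REFUTED (B = 0, kernel), `GluedDominated′` FALSE (exact LP witness above; kernel ¬ open), `GluedDominatedMass`, `GluedLemmaW`, the band,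
`SiblingStep`, `FarTreeRow` OPEN; RATE class (log\*) / honest sentence of `run/shared/lean/prim/quant/README.md` unchanged.  [this work].  Nothing here is cited as a
published result.  The gluing rows served [cite: KozmaNitzan2024, Conjecture 3 (p. 15)]; product measure [cite: Grimmett1999, §1.3 p. 10].
-/

noncomputable section

open scoped BigOperators

namespace Summit.CriticalPhenomena.PercolationContinuityZ3.Theorems
namespace Quant

open Finset

namespace LawDec

/-- the point mass `δ_K` -/
local notation3 "δ[" K "]" => (fun k : ℕ => if k = (K : ℕ) then (1 : ℝ) else 0)

/-- the two-point law `{lo, lo+K; g}` = `lo` sure relays and a blob of size `K` at gate `g` -/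
local notation3 "TPL[" lo ", " K ", " g "]" => lconv lo K δ[lo] (gate δ[K] g)


/-! ### The refutation of `GluedDominated′` (no mass row) -/

/-- **`GluedDominated′` AS TYPED IS FALSE.**  Instance `x = q = 19/20`, `g = 1`, `r = 1`, `k = 5`, `a = 49/50`, `S = 19/10`, `B = 2`, `j = 2` (double edge `x = qg`, `S = xB`;
`y = 931/1000`, `T₀ = 931/500`, `T = 931/125`), certificate `α ≡ 1`, `p ≡ 69/931` (all three lows `0,1,2` at the giant price; admissible).  The pullback is `Ψ ≡ −1/49` on
`{0,1,2}`; the atoms `1, 2` are never `J`-lows (`2 ≥ T₀`), so any certificate has rows `−1/49 ≤ −β′1 − (9/10)λ`, `−1/49 ≤ −β′2 + λ/10`, the gate row forces `α′0 ≥ 1`, and the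
zero's pair condition towards `2` (a giant for `J ≤ 1`, a mid at the minimal gate `y` for `J = 2`; usage `931/69` either way) forces `β′2 ≥ 69/931`; with `β′1 ≥ 0` the
combination `19/621·(row 1) + 19/69·(row 2)` — the sub-probability flow witness `β = {1: 19/621, 2: 19/69}` of the dual LP — is contradictory.  The glued-piece slice itself
holds here (a heavy blob slice); only the `d`-free certificate family is incomplete. [this work] -/
theorem not_gluedDominated' : ¬ GluedDominated' := by
  intro h
  have hval : ∀ l h' : ℕ, l ≤ 2 → 2 * (l : ℝ) < 49 / 50 * (19 / 10 + 19 / 20 * ((1 : ℕ) + (5 : ℕ) * (1 : ℝ))) → h' ≤ 2 + (1 + 5) →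
      (2 + 1 ≤ h' ∨ 49 / 50 * (19 / 10 + 19 / 20 * ((1 : ℕ) + (5 : ℕ) * (1 : ℝ))) < (l : ℝ) + h') →
      (fun _ : ℕ => (1 : ℝ)) l ≤ usage (49 / 50 * (19 / 20)) (49 / 50 * (19 / 10 + 19 / 20 * ((1 : ℕ) + (5 : ℕ) * (1 : ℝ)))) 2 l h' * (fun _ : ℕ => (69 / 931 : ℝ)) h' := by
    intro l h' hl hlT hh' hcomp
    have hg : 2 + 1 ≤ h' := by
      rcases hcomp with hg | hm
      · exact hg
      · by_contra hc
        have h1 : (h' : ℝ) ≤ 2 := by exact_mod_cast (show h' ≤ 2 by omega)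
        have h2 : (l : ℝ) ≤ 2 := by exact_mod_cast hl
        push_cast at hm
        linarith
    show (1 : ℝ) ≤ usage (49 / 50 * (19 / 20)) _ 2 l h' * (69 / 931)
    rw [usage_giant_eq _ _ 2 l h' hg]
    norm_num
  obtain ⟨J, α', β', lam, hJB, hβ', hpairs, hrows, hgate⟩ :=
    h (19 / 20) (49 / 50) (19 / 20) 1 (19 / 10) 2 1 5 2 (fun _ => 1) (fun _ => 69 / 931)
      (by norm_num) (by norm_num) (by norm_num) (by norm_num) (by norm_num) (by norm_num) (by norm_num) le_rfl le_rfl (by norm_num)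
      (by norm_num) (by push_cast; norm_num) (by push_cast; norm_num) (by norm_num) (by push_cast; norm_num) (by push_cast; norm_num) (by norm_num)
      (fun _ => by norm_num) hval
  -- the pullback at 1 and 2
  have hΨ : ∀ hh : ℕ, hh = 1 ∨ hh = 2 →
      gluedPullback (49 / 50 * (19 / 10 + 19 / 20 * ((1 : ℕ) + (5 : ℕ) * (1 : ℝ)))) (19 / 20) 1 2 1 5 (fun _ => (1 : ℝ)) (fun _ => (69 / 931 : ℝ)) hh
        = -1 / 49 := by
    intro hh hhh
    unfold gluedPullback coefAt
    have c1 : hh ≤ 2 ∧ 2 * (hh : ℝ) < 49 / 50 * (19 / 10 + 19 / 20 * ((1 : ℕ) + (5 : ℕ) * (1 : ℝ))) := by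
      rcases hhh with e | e <;> subst e <;> refine ⟨by norm_num, by push_cast; norm_num⟩
    have c3 : ¬ (hh + 1 + 5 ≤ 2 ∧ 2 * ((hh + 1 + 5 : ℕ) : ℝ) < 49 / 50 * (19 / 10 + 19 / 20 * ((1 : ℕ) + (5 : ℕ) * (1 : ℝ)))) := fun hc => by omega
    rw [if_pos c1, if_neg c3]
    norm_num
  -- rows 1 and 2: these atoms are never J-lows
  have hn1 : ¬ ((1 : ℕ) ≤ J ∧ 2 * ((1 : ℕ) : ℝ) < 49 / 50 * (19 / 10)) := fun hc => by norm_num at hc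
  have hn2 : ¬ ((2 : ℕ) ≤ J ∧ 2 * ((2 : ℕ) : ℝ) < 49 / 50 * (19 / 10)) := fun hc => by norm_num at hc
  have r1 := hrows 1 (by norm_num)
  have r2 := hrows 2 (by norm_num)
  rw [hΨ 1 (Or.inl rfl)] at r1
  rw [hΨ 2 (Or.inr rfl)] at r2
  unfold coefAt at r1 r2
  rw [if_neg hn1] at r1
  rw [if_neg hn2] at r2
  push_cast at r1 r2
  -- the gate row: α′0 ≥ 1
  have h0low : (0 : ℕ) ≤ J ∧ 2 * ((0 : ℕ) : ℝ) < 49 / 50 * (19 / 10) := ⟨Nat.zero_le _, by norm_num⟩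
  have h0T : (0 : ℕ) ≤ 2 ∧ 2 * ((0 : ℕ) : ℝ) < 49 / 50 * (19 / 10 + 19 / 20 * ((1 : ℕ) + (5 : ℕ) * (1 : ℝ))) := ⟨Nat.zero_le _, by push_cast; norm_num⟩
  unfold coefAt at hgate
  rw [if_pos h0T, if_pos h0low] at hgate
  have hg1 : (1 : ℝ) ≤ α' 0 := by linarith
  -- the zero's pair condition towards 2
  have hu : usage (49 / 50 * (19 / 20)) (49 / 50 * (19 / 10)) J 0 2 = 931 / 69 := by
    by_cases hJ : J + 1 ≤ 2
    · rw [usage_giant_eq _ _ J 0 2 hJ]; norm_num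
    · have hnj : ¬ (J + 1 ≤ 2) := hJ
      simp only [usage, gateOf, if_neg hnj, pairGate]
      norm_num
  have hp2 := hpairs 0 2 (Nat.zero_le _) (by norm_num) le_rfl (by
    by_cases hJ : J + 1 ≤ 2
    · exact Or.inl hJ
    · right; push_cast; norm_num)
  rw [hu] at hp2
  have hb1 := hβ' 1
  nlinarith [hg1, hp2, hb1, r1, r2]

/-- **CONJECTURE (single-layer domination with mean tilt AND mass shift; the statement of record for the band).**  As `GluedDominated′`, the certificate being
`(J, α′, β′, λ, d)`: a price system of `gate_a β` at one layer `J ≤ B`, a multiple `λ` of the mean identity and a multiple `d` of the mass identity, dominating the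
pullback row by row and paying the gate row.  EVIDENCE: the file header (every recorded failure of the `d`-free form certified; kit re-run with the mass row ⧗ j290356/58).
[this work] [status: open] -/
@[conjecture] def GluedDominatedMass : Prop :=
  ∀ (x a q g S : ℝ) (B r k j : ℕ) (α p : ℕ → ℝ),
    0 < x → x < 1 → 0 < a → a ≤ 1 → 0 < q → q < 1 → 0 ≤ g → g ≤ 1 → 1 ≤ r → 1 ≤ k →
    x ≤ q * g → 2 * (r : ℝ) < q * ((r : ℝ) + k * g) → q * ((r : ℝ) + k * g) - r < (k : ℝ) * x →
    1 ≤ B → x * (B : ℝ) ≤ S → S ≤ (B : ℝ) → j < B + (r + k) →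
    (∀ h, 0 ≤ p h) →
    (∀ l h, l ≤ j → 2 * (l : ℝ) < a * (S + q * ((r : ℝ) + k * g)) → h ≤ B + (r + k) →
      (j + 1 ≤ h ∨ a * (S + q * ((r : ℝ) + k * g)) < (l : ℝ) + h) →
      α l ≤ usage (a * x) (a * (S + q * ((r : ℝ) + k * g))) j l h * p h) →
    ∃ (J : ℕ) (α' β' : ℕ → ℝ) (lam d : ℝ), J ≤ B ∧ (∀ h, 0 ≤ β' h) ∧
      (∀ l h, l ≤ J → 2 * (l : ℝ) < a * S → h ≤ B → (J + 1 ≤ h ∨ a * S < (l : ℝ) + h) →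
        α' l ≤ usage (a * x) (a * S) J l h * β' h) ∧
      (∀ h, h ≤ B → gluedPullback (a * (S + q * ((r : ℝ) + k * g))) q g j r k α p h
        ≤ coefAt (a * S) J α' β' h + lam * ((h : ℝ) - S) + d) ∧
      (1 - a) * coefAt (a * (S + q * ((r : ℝ) + k * g))) j α p 0 ≤ (1 - a) * coefAt (a * S) J α' β' 0 - a * d



/-- **`GluedDominatedMass` ⟹ THE GLUED-PIECE SLICE IN THE BAND** — as `sdec_gluedPiece_band_of_dominated′`, the rows now carrying `+ d` and the gate row `− a·d`;
the two cancel through `Σ_h β(h) = 1`. [this work] -/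
theorem sdec_gluedPiece_band_of_dominatedMass (hD : GluedDominatedMass) {x : ℝ} (hx0 : 0 < x) (hx1 : x < 1) {B : ℕ} {β : ℕ → ℝ}
    (β0 : ∀ h, 0 ≤ β h) (βM : ∀ h, B < h → β h = 0) (β1 : ∑ h ∈ Finset.range (B + 1), β h = 1)
    (hta : x * (B : ℝ) ≤ ∑ h ∈ Finset.range (B + 1), (h : ℝ) * β h) (hS : SDEC x B β)
    (q g : ℝ) (r k : ℕ) (hq0 : 0 < q) (hq1 : q < 1) (hg0 : 0 ≤ g) (hg1 : g ≤ 1) (hr : 1 ≤ r) (hk : 1 ≤ k)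
    (hxqg : x ≤ q * g) (hband1 : 2 * (r : ℝ) < q * ((r : ℝ) + k * g)) (hband2 : q * ((r : ℝ) + k * g) - r < (k : ℝ) * x) :
    SDEC x (B + (r + k)) (lconv B (r + k) β (gate (TPL[r, k, g]) q)) := by
  by_cases hB1 : 1 ≤ B
  swap
  · -- B = 0: β = δ₀ and β ∗ t = t, SDEC by `sdec_glued`
    have hB0 : B = 0 := by omega
    subst hB0
    have hβ0 : β 0 = 1 := by simpa using β1
    have eβ : β = fun i => if i = 0 then (1 : ℝ) else 0 := by
      funext i
      by_cases hi : i = 0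
      · rw [if_pos hi, hi, hβ0]
      · rw [if_neg hi]; exact βM i (by omega)
    obtain ⟨t0, tM, t1, tmn⟩ := glued_laws q g r k hq0.le hq1.le hg0 hg1
    have e : lconv 0 (r + k) β (gate (TPL[r, k, g]) q) = gate (TPL[r, k, g]) q := by
      funext u; rw [eβ]; exact lconv_delta_left 0 (r + k) _ tM u
    rw [e, Nat.zero_add]
    exact sdec_glued x q g r k hx0 hx1 hq0 hq1.le hg0 hg1 hxqg
  set S : ℝ := ∑ h ∈ Finset.range (B + 1), (h : ℝ) * β h with hSdef
  set m : ℝ := q * ((r : ℝ) + k * g) with hmdef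
  set t : ℕ → ℝ := gate (TPL[r, k, g]) q with htdef
  obtain ⟨t0, tM, t1, tmn⟩ := glued_laws q g r k hq0.le hq1.le hg0 hg1
  -- mean of β is at most its top
  have hSB : S ≤ (B : ℝ) := by
    have : ∑ h ∈ Finset.range (B + 1), (h : ℝ) * β h ≤ ∑ h ∈ Finset.range (B + 1), (B : ℝ) * β h :=
      Finset.sum_le_sum fun h hh => mul_le_mul_of_nonneg_right
        (by exact_mod_cast Nat.lt_succ_iff.1 (Finset.mem_range.1 hh)) (β0 h)
    rw [← Finset.mul_sum, β1, mul_one] at this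
    exact this
  intro a ha0 ha1 j hj
  -- law facts of ν_a = gate (β ∗ t) a
  have c1 : ∑ h ∈ Finset.range (B + (r + k) + 1), lconv B (r + k) β t h = 1 := sum_lconv B (r + k) β t β1 t1
  obtain ⟨n0, nM, n1⟩ := gate_laws (B + (r + k)) (lconv B (r + k) β t) a ha0.le ha1
    (lconv_nonneg B (r + k) β t β0 t0) (fun h hh => lconv_eq_zero B (r + k) β t h hh) c1
  have nmean : ∑ h ∈ Finset.range (B + (r + k) + 1), (h : ℝ) * gate (lconv B (r + k) β t) a h = a * (S + m) := by
    rw [sum_mul_gate, sum_mul_lconv B (r + k) β t β1 t1, tmn]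
  have hy0 : 0 < a * x := mul_pos ha0 hx0
  have hy1 : a * x < 1 := by nlinarith
  rw [decAt_iff_decAtT, nmean, decAtT_iff_prices (a * x) _ j (B + (r + k)) _ hy0 hy1 nM n1]
  intro α p hp hαp
  have hjM : j ≤ B + (r + k) := hj.le
  -- the certificate functional
  have hfun := dual_functional_eq (a * (S + m)) j (B + (r + k)) α p (gate (lconv B (r + k) β t) a) hjM
  rw [htdef, glued_functional_eq B r k β (coefAt (a * (S + m)) j α p) q g a hr] at hfun
  -- the dominating layer
  obtain ⟨J, α', β', lam, d, hJB, hβ', hαβ', hrows, hgate⟩ :=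
    hD x a q g S B r k j α p hx0 hx1 ha0 ha1 hq0 hq1 hg0 hg1 hr hk hxqg hband1 hband2 hB1 hta hSB hj hp hαp
  -- G = gate β a is DEC(J) at its mean a·S
  obtain ⟨G0, GM, G1⟩ := gate_laws B β a ha0.le ha1 β0 βM β1
  have Gmean : ∑ h ∈ Finset.range (B + 1), (h : ℝ) * gate β a h = a * S := by rw [sum_mul_gate]
  have hdecJ : DECAtT (a * x) (a * S) J B (gate β a) := by
    rw [← Gmean, ← decAt_iff_decAtT]
    rcases Nat.lt_or_ge J B with hJlt | hJge
    · exact hS a ha0 ha1 J hJlt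
    · refine decAt_of_top_le B (gate β a) G0 GM G1 (a * x) hy1 (fun h hh => ?_) J hJge
      have hhB : h ≤ B := by
        by_contra hc
        exact absurd (GM h (not_le.1 hc)) (ne_of_gt hh)
      rw [Gmean]
      have h1 : a * x * (h : ℝ) ≤ a * x * (B : ℝ) := mul_le_mul_of_nonneg_left (by exact_mod_cast hhB) hy0.le
      have h2 : a * (x * (B : ℝ)) ≤ a * S := mul_le_mul_of_nonneg_left hta ha0.le
      linarith
  have wd := dual_le_of_decAtT (a * x) (a * S) J B (gate β a) hy0 hy1 hdecJ α' β' hβ' hαβ'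
  have wd_eq := dual_functional_eq (a * S) J B α' β' (gate β a) hJB
  rw [gate_functional_eq B β (coefAt (a * S) J α' β') a] at wd_eq
  -- the mean identity
  have hmeanid : ∑ h ∈ Finset.range (B + 1), β h * (lam * ((h : ℝ) - S)) = 0 := by
    have : ∑ h ∈ Finset.range (B + 1), β h * (lam * ((h : ℝ) - S))
        = lam * (∑ h ∈ Finset.range (B + 1), (h : ℝ) * β h - S * ∑ h ∈ Finset.range (B + 1), β h) := by
      rw [Finset.mul_sum, ← Finset.sum_sub_distrib, Finset.mul_sum]
      refine Finset.sum_congr rfl fun h _ => by ring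
    rw [this, β1, mul_one, hSdef, sub_self, mul_zero]
  -- row-by-row domination
  have hle : ∑ h ∈ Finset.range (B + 1), β h * gluedPullback (a * (S + m)) q g j r k α p h
      ≤ ∑ h ∈ Finset.range (B + 1), β h * (coefAt (a * S) J α' β' h + lam * ((h : ℝ) - S) + d) :=
    Finset.sum_le_sum fun h hh => mul_le_mul_of_nonneg_left (hrows h (Nat.lt_succ_iff.1 (Finset.mem_range.1 hh))) (β0 h)
  have hsplit : ∑ h ∈ Finset.range (B + 1), β h * (coefAt (a * S) J α' β' h + lam * ((h : ℝ) - S) + d)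
      = ∑ h ∈ Finset.range (B + 1), β h * coefAt (a * S) J α' β' h + ∑ h ∈ Finset.range (B + 1), β h * (lam * ((h : ℝ) - S))
        + ∑ h ∈ Finset.range (B + 1), d * β h := by
    rw [← Finset.sum_add_distrib, ← Finset.sum_add_distrib]
    exact Finset.sum_congr rfl fun h _ => by ring
  have hdsum : ∑ h ∈ Finset.range (B + 1), d * β h = d := by rw [← Finset.mul_sum, β1, mul_one]
  rw [hsplit, hmeanid, add_zero, hdsum] at hle
  have hΨ : ∀ h, (1 - q) * coefAt (a * (S + m)) j α p h + q * (1 - g) * coefAt (a * (S + m)) j α p (h + r)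
      + q * g * coefAt (a * (S + m)) j α p (h + r + k) = gluedPullback (a * (S + m)) q g j r k α p h := fun h => rfl
  simp_rw [hΨ] at hfun
  -- assemble
  have hG : (1 - a) * coefAt (a * S) J α' β' 0 + a * ∑ h ∈ Finset.range (B + 1), β h * coefAt (a * S) J α' β' h ≤ 0 := by
    rw [← wd_eq]; linarith
  have hfin : (1 - a) * coefAt (a * (S + m)) j α p 0 + a * ∑ h ∈ Finset.range (B + 1), β h * gluedPullback (a * (S + m)) q g j r k α p h ≤ 0 := by
    have := mul_le_mul_of_nonneg_left hle ha0.le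
    linarith
  linarith [hfun ▸ hfin]



/-- **`GluedDominatedMass` ⟹ THE GLUED-PIECE SLICE, ALL REGIMES** (g57's hypothesis `hGPS` verbatim). [this work] -/
theorem gluedPieceSlice_of_dominatedMass (hD : GluedDominatedMass) {x : ℝ} (hx0 : 0 < x) (hx1 : x < 1) :
    ∀ (B' : ℕ) (β' : ℕ → ℝ) (r k : ℕ) (q g : ℝ), (∀ h, 0 ≤ β' h) → (∀ h, B' < h → β' h = 0) →
      ∑ h ∈ Finset.range (B' + 1), β' h = 1 → x * (B' : ℝ) ≤ ∑ h ∈ Finset.range (B' + 1), (h : ℝ) * β' h → SDEC x B' β' →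
      0 < q → q < 1 → 0 ≤ g → g ≤ 1 → 1 ≤ r → 1 ≤ k → x ≤ q * g → x * ((r : ℝ) + k) ≤ q * ((r : ℝ) + k * g) →
      SDEC x (B' + (r + k)) (lconv B' (r + k) β' (gate (TPL[r, k, g]) q)) :=
  gluedPieceSlice_of_band hx0 hx1 fun _ _ r k q g β0 βM β1 hta hS hq0 hq1 hg0 hg1 hr hk hxqg hb1 hb2 =>
    sdec_gluedPiece_band_of_dominatedMass hD hx0 hx1 β0 βM β1 hta hS q g r k hq0 hq1 hg0 hg1 hr hk hxqg hb1 hb2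

/-- **`GluedDominatedMass` ⟹ EVERY SIBLING WITH OK PIECES IS ADJOINABLE** (g57's `sdec_cons_of_okPieces`, `hGPS` discharged from the statement of record). [this work] -/
theorem sdec_cons_of_okPieces_of_dominatedMass (hD : GluedDominatedMass) {x : ℝ} (hx0 : 0 < x) (hx1 : x < 1)
    (L : List Sib) (s : Sib) (hL : ∀ t ∈ L, t.LawOK) (hxL : ∀ t ∈ L, x * (t.M : ℝ) ≤ t.q * t.mean) (hS : SDEC x (ftop L) (flaw L))
    (hs : s.LawOK) (hxs : x * (s.M : ℝ) ≤ s.q * s.mean)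
    {ι : Type} [Fintype ι] (w : ι → ℝ) (lo K : ι → ℕ) (γ : ι → ℝ)
    (hw0 : ∀ i, 0 ≤ w i) (hw1 : ∑ i, w i = 1) (hγ : ∀ i, 0 ≤ γ i ∧ γ i ≤ 1) (htop : ∀ i, lo i + K i ≤ s.M)
    (hmean : ∀ i, (lo i : ℝ) + K i * γ i = s.mean) (hmix : ∀ h, s.ρ h = ∑ i, w i * (TPL[lo i, K i, γ i]) h)
    (hOK : ∀ i, (K i : ℝ) * γ i ≤ lo i ∨ lo i = 0 ∨ x * (K i : ℝ) ≤ s.q * ((lo i : ℝ) + K i * γ i) - lo i ∨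
      (1 ≤ lo i ∧ 1 ≤ K i ∧ x ≤ s.q * γ i)) :
    SDEC x (ftop (s :: L)) (flaw (s :: L)) :=
  sdec_cons_of_okPieces hx0 hx1 (gluedPieceSlice_of_dominatedMass hD hx0 hx1) L s hL hxL hS hs hxs w lo K γ hw0 hw1 hγ htop hmean hmix hOK

/-- **at the trivial gate LEMMA W is everything** — `GluedLemmaW ⟹` the conclusion of `GluedDominatedMass` at `a = 1` (mass shift `d = 0`). [this work] -/
theorem gluedDominatedMass_one_of_lemmaW (hW : GluedLemmaW) (x q g S : ℝ) (B r k j : ℕ) (α p : ℕ → ℝ)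
    (hx0 : 0 < x) (hx1 : x < 1) (hq0 : 0 < q) (hq1 : q < 1) (hg0 : 0 ≤ g) (hg1 : g ≤ 1) (hr : 1 ≤ r) (hk : 1 ≤ k)
    (hxqg : x ≤ q * g) (hband1 : 2 * (r : ℝ) < q * ((r : ℝ) + k * g)) (hband2 : q * ((r : ℝ) + k * g) - r < (k : ℝ) * x)
    (hB1 : 1 ≤ B) (hSB1 : x * (B : ℝ) ≤ S) (hSB2 : S ≤ (B : ℝ)) (hjM : j < B + (r + k))
    (hp : ∀ h, 0 ≤ p h)
    (hαp : ∀ l h, l ≤ j → 2 * (l : ℝ) < 1 * (S + q * ((r : ℝ) + k * g)) → h ≤ B + (r + k) →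
      (j + 1 ≤ h ∨ 1 * (S + q * ((r : ℝ) + k * g)) < (l : ℝ) + h) →
      α l ≤ usage (1 * x) (1 * (S + q * ((r : ℝ) + k * g))) j l h * p h) :
    ∃ (J : ℕ) (α' β' : ℕ → ℝ) (lam d : ℝ), J ≤ B ∧ (∀ h, 0 ≤ β' h) ∧
      (∀ l h, l ≤ J → 2 * (l : ℝ) < 1 * S → h ≤ B → (J + 1 ≤ h ∨ 1 * S < (l : ℝ) + h) →
        α' l ≤ usage (1 * x) (1 * S) J l h * β' h) ∧
      (∀ h, h ≤ B → gluedPullback (1 * (S + q * ((r : ℝ) + k * g))) q g j r k α p h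
        ≤ coefAt (1 * S) J α' β' h + lam * ((h : ℝ) - S) + d) ∧
      (1 - (1 : ℝ)) * coefAt (1 * (S + q * ((r : ℝ) + k * g))) j α p 0 ≤ (1 - (1 : ℝ)) * coefAt (1 * S) J α' β' 0 - 1 * d := by
  obtain ⟨J, α', β', lam, hJB, hβ', hpairs, hrows, _⟩ :=
    gluedDominated_one_of_lemmaW hW x q g S B r k j α p hx0 hx1 hq0 hq1 hg0 hg1 hr hk hxqg hband1 hband2 hB1 hSB1 hSB2 hjM hp hαp
  exact ⟨J, α', β', lam, 0, hJB, hβ', hpairs, fun h hh => by rw [add_zero]; exact hrows h hh, by simp⟩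

end LawDec
end Quant
end Summit.CriticalPhenomena.PercolationContinuityZ3.Theorems
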